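import Mathlib
import Literature.MathematicalPhysics.QuantumLattice.DWaveSource
import Literature.MathematicalPhysics.QuantumLattice.DWaveSourceProofs
import Literature.MathematicalPhysics.QuantumLattice.GroundStateSourceBounds
import Literature.MathematicalPhysics.QuantumLattice.FinDimSpectrumProofs
import Literature.MathematicalPhysics.QuantumLattice.PairCorrelations
import Literature.MathematicalPhysics.QuantumLattice.HubbardModel
import HarnessLib

/-!
# Crux `WcbcsSsbToTorusLRO` (stmt-HubbardSuperconductivity-2009), line `off-zero-mode-moment-closure` ⊕ N-half of
# `neutral-curvature-face-purity`: the RESPONSE (Hellmann–Feynman / Griffiths) form of the neutral-curvature floor (N)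

Companion to the registered stub (N) `stub_neutralCurvature` (analysis by the lead's wave-1 stub-worker, 2026-08-17):
(N) is EQUIVALENT to an `h`-uniform Lipschitz bound on the block-coherence RESPONSE of the interacting sourced torus,
and the tree supplies unconditionally only the LINEAR (`κ¹`) floor — the missing power of `κ` is exactly that response bound. With `f(κ) = E₀(T + κW)` for Hermitian
`T`, `W` and `ω_κ` the tracial ground state of `T + κW`:

* `nc_secondDifference_groundEnergy_le_zero` — concavity: `f(κ) + f(−κ) − 2f(0) ≤ 0`;
* `nc_response_mul_le_secondDifference_groundEnergy` — the Hellmann–Feynman chords: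
  `κ · (Re ω_κ(W) − Re ω_{−κ}(W)) ≤ f(κ) + f(−κ) − 2f(0)` (the ground states of `T ± κW` are trial states for `T`);
* `nc_neg_two_mul_norm_le_secondDifference_groundEnergy` — hence the UNCONDITIONAL linear floor
  `−2κ‖W‖ ≤ f(κ) + f(−κ) − 2f(0)` (`κ ≥ 0`), and, with `‖W_R‖ ≤ (2Σ_e|g_e/√2|)² L²` for the Kac block operator
  (`nc_norm_blockRepulsion_le`), the finite-`L`, all-`(U, μ, h, κ, R)` statement `nc_secondDifference_ge_linear`:
  the tree proves (N) with `κ²` replaced by `κ` and NOTHING in between — the missing power of `κ` is exactly a bound on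
  the RESPONSE `Re ω_{−κ}(W_R) − Re ω_κ(W_R) ≤ C κ L²` (Lipschitz continuity of the block coherence across `κ = 0`);
* `stub_neutralCurvature_of_responseLipschitz` — the registered signature of (N) VERBATIM from that response bound
  (`NeutralResponseLipschitz`, stated inline as the hypothesis; same guard, same quantifier prefix, same constant);
* `nc_sub_mul_response_le`, `responseLipschitz_of_stub_neutralCurvature`, `stub_neutralCurvature_iff_responseLipschitz`
  — the Griffiths direction (concavity at step `κ` + the floor at step `2κ` ⇒ response `≤ 4Cκ(L+1)²` on `(0, κ₀/2)`),
  hence (N) ⟺ NeutralResponseLipschitz as propositions: the registered stub is already in minimal form, its whole content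
  is an `h`-uniform bound on a ground-state RESPONSE of the interacting sourced torus (supplier: the crux-4 engine).

No definition is introduced; [folklore] finite-dimensional linear algebra over the tree's `GroundStateSourceBounds`.
-/

noncomputable section

set_option linter.dupNamespace false

namespace Summit.HubbardSuperconductivity.HubbardSuperconductivity.Theorems.WcbcsSsbToTorusLRO

open Literature.MathematicalPhysics.QuantumLattice Literature.Probability.LatticeModels
open Matrix Filter Set
open scoped ComplexOrder ComplexConjugate Matrix.Norms.L2Operator

section Abstract

variable {n : Type*} [Fintype n] [DecidableEq n] [Nonempty n]

/-- **Concavity of the ground energy in a coupling (upper Griffiths sandwich).** For Hermitian `T`, `W` and real `κ`,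
`E₀(T + κW) + E₀(T − κW) − 2E₀(T) ≤ 0` (the ground state of `T` is a trial state for `T ± κW`). [folklore] -/
theorem nc_secondDifference_groundEnergy_le_zero {T W : Matrix n n ℂ} (hT : T.IsHermitian) (hW : W.IsHermitian)
    (κ : ℝ) :
    (T + (κ : ℂ) • W).groundEnergy + (T + ((-κ : ℝ) : ℂ) • W).groundEnergy - 2 * T.groundEnergy ≤ 0 := by
  have e1 : T + (κ : ℂ) • W = T - ((-κ : ℝ) : ℂ) • W := by
    rw [Complex.ofReal_neg, neg_smul, sub_neg_eq_add]
  have e2 : T + ((-κ : ℝ) : ℂ) • W = T - (κ : ℂ) • W := by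
    rw [Complex.ofReal_neg, neg_smul, sub_eq_add_neg]
  have h1 := sub_mul_re_groundStateFunctional_le hT hW 0 (-κ)
  have h2 := sub_mul_re_groundStateFunctional_le hT hW 0 κ
  simp only [Complex.ofReal_zero, zero_smul, sub_zero] at h1 h2
  rw [← e1] at h1
  rw [← e2] at h2
  linarith

/-- **Hellmann–Feynman chords (lower Griffiths sandwich).** For Hermitian `T`, `W` and real `κ`,
`κ · (Re ω_{T+κW}(W) − Re ω_{T−κW}(W)) ≤ E₀(T + κW) + E₀(T − κW) − 2E₀(T)`, `ω_A` the tracial ground state of `A`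
(the ground states of `T ± κW` are trial states for `T`; tree `sub_mul_re_groundStateFunctional_le` twice). So a
quadratic floor `−Cκ²L²` on the second difference is IMPLIED BY the response bound
`Re ω_{T−κW}(W) − Re ω_{T+κW}(W) ≤ CκL²`, and (N) is a Lipschitz bound on the block-coherence response across
`κ = 0`. [folklore] -/
theorem nc_response_mul_le_secondDifference_groundEnergy {T W : Matrix n n ℂ} (hT : T.IsHermitian)
    (hW : W.IsHermitian) (κ : ℝ) :
    κ * (((T + (κ : ℂ) • W).groundStateFunctional W).re -
        ((T + ((-κ : ℝ) : ℂ) • W).groundStateFunctional W).re) ≤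
      (T + (κ : ℂ) • W).groundEnergy + (T + ((-κ : ℝ) : ℂ) • W).groundEnergy - 2 * T.groundEnergy := by
  have e1 : T + (κ : ℂ) • W = T - ((-κ : ℝ) : ℂ) • W := by
    rw [Complex.ofReal_neg, neg_smul, sub_neg_eq_add]
  have e2 : T + ((-κ : ℝ) : ℂ) • W = T - (κ : ℂ) • W := by
    rw [Complex.ofReal_neg, neg_smul, sub_eq_add_neg]
  have h1 := sub_mul_re_groundStateFunctional_le hT hW (-κ) 0
  have h2 := sub_mul_re_groundStateFunctional_le hT hW κ 0
  simp only [Complex.ofReal_zero, zero_smul, sub_zero, zero_sub, neg_neg] at h1 h2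
  rw [← e1] at h1
  rw [← e2] at h2
  linarith

/-- **Chord bound on the response at a smaller step (the Griffiths direction).** For Hermitian `T`, `W` and real
`κ'`, `κ`: `(κ − κ') · (Re ω_{T−κ'W}(W) − Re ω_{T+κ'W}(W)) ≤ [E₀(T+κ'W) + E₀(T−κ'W)] − [E₀(T+κW) + E₀(T−κW)]`
(supergradient inequalities of the concave `s ↦ E₀(T + sW)` at `±κ'` towards `±κ`). With concavity at `κ'` and a
floor `−Cκ²` at `κ = 2κ'` this gives `Re ω_{−κ'}(W) − Re ω_{κ'}(W) ≤ 4Cκ'`: the quadratic floor and the Lipschitz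
response bound are EQUIVALENT up to constants. [folklore] -/
theorem nc_sub_mul_response_le {T W : Matrix n n ℂ} (hT : T.IsHermitian) (hW : W.IsHermitian) (κ' κ : ℝ) :
    (κ - κ') * (((T + ((-κ' : ℝ) : ℂ) • W).groundStateFunctional W).re -
        ((T + (κ' : ℂ) • W).groundStateFunctional W).re) ≤
      ((T + (κ' : ℂ) • W).groundEnergy + (T + ((-κ' : ℝ) : ℂ) • W).groundEnergy) -
        ((T + (κ : ℂ) • W).groundEnergy + (T + ((-κ : ℝ) : ℂ) • W).groundEnergy) := by
  have e1 : ∀ s : ℝ, T + (s : ℂ) • W = T - ((-s : ℝ) : ℂ) • W := fun s => by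
    rw [Complex.ofReal_neg, neg_smul, sub_neg_eq_add]
  have e2 : ∀ s : ℝ, T + ((-s : ℝ) : ℂ) • W = T - (s : ℂ) • W := fun s => by
    rw [Complex.ofReal_neg, neg_smul, sub_eq_add_neg]
  have h1 := sub_mul_re_groundStateFunctional_le hT hW (-κ') (-κ)
  have h2 := sub_mul_re_groundStateFunctional_le hT hW κ' κ
  rw [← e1 κ', ← e1 κ] at h1
  rw [← e2 κ', ← e2 κ] at h2
  linarith

/-- **The unconditional LINEAR floor.** For Hermitian `T`, `W` and `κ ≥ 0`,
`−2κ‖W‖ ≤ E₀(T + κW) + E₀(T − κW) − 2E₀(T)` (`|Re ω(W)| ≤ ‖W‖` in the two chords). This is all that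
finite-dimensional linear algebra gives without a bound on the response: one power of `κ` short of (N). [folklore] -/
theorem nc_neg_two_mul_norm_le_secondDifference_groundEnergy {T W : Matrix n n ℂ} (hT : T.IsHermitian)
    (hW : W.IsHermitian) {κ : ℝ} (hκ : 0 ≤ κ) :
    -(2 * κ * ‖W‖) ≤
      (T + (κ : ℂ) • W).groundEnergy + (T + ((-κ : ℝ) : ℂ) • W).groundEnergy - 2 * T.groundEnergy := by
  have key := nc_response_mul_le_secondDifference_groundEnergy hT hW κ
  have hp : (T + (κ : ℂ) • W).IsHermitian := by
    refine hT.add (IsHermitian.smul hW ?_)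
    rw [isSelfAdjoint_iff, Complex.star_def, Complex.conj_ofReal]
  have hm : (T + ((-κ : ℝ) : ℂ) • W).IsHermitian := by
    refine hT.add (IsHermitian.smul hW ?_)
    rw [isSelfAdjoint_iff, Complex.star_def, Complex.conj_ofReal]
  have a1 := abs_le.mp (abs_re_groundStateFunctional_le_norm hp W)
  have a2 := abs_le.mp (abs_re_groundStateFunctional_le_norm hm W)
  nlinarith [a1.1, a2.2]

end Abstract

/-! ### The Kac block operator `W_R = R⁻⁴ Σ_a B_aᴴ B_a` of the stub: Hermiticity and norm -/

section Block

variable (L : ℕ) [NeZero L]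

/-- The Kac block operator `W_R = R⁻⁴ Σ_a B_aᴴ B_a` is Hermitian (a real multiple of a sum of `XᴴX`).
[folklore] -/
-- adapted from `Theorems/ChiralWindowCwSsbToEvenTorusLROBlockSlope.lean` (private `isHermitian_blockRepulsion`)
theorem nc_isHermitian_blockRepulsion (R : ℕ) :
    ((((((R : ℝ) ^ 4)⁻¹ : ℝ) : ℂ) • ∑ a : Literature.Probability.LatticeModels.TorusSite 2 L, (∑ u : Fin 2 → Fin R, localPair dWaveFormFactor L (a + fun i => ((u i : ℕ) : ZMod L)))ᴴ * (∑ u : Fin 2 → Fin R, localPair dWaveFormFactor L (a + fun i => ((u i : ℕ) : ZMod L))))).IsHermitian := by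
  refine IsHermitian.smul ?_ ?_
  · exact (isSelfAdjoint_sum _ fun a _ =>
      (isHermitian_conjTranspose_mul_self _).isSelfAdjoint).isHermitian
  · rw [isSelfAdjoint_iff, Complex.star_def, Complex.conj_ofReal]


/-- Norm of one block: `‖B_a‖ ≤ R² · 2Σ_e|g_e/√2|` (`R²` local pairs, tree `norm_localPair_le`). [folklore] -/
theorem nc_norm_blockPair_le (R : ℕ) (a : Literature.Probability.LatticeModels.TorusSite 2 L) :
    ‖∑ u : Fin 2 → Fin R, localPair dWaveFormFactor L (a + fun i => ((u i : ℕ) : ZMod L))‖ ≤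
      (R : ℝ) ^ 2 * (2 * ∑ e ∈ insert (0 : Site 2) unitSteps, |dWaveFormFactor e / Real.sqrt 2|) := by
  refine (norm_sum_le _ _).trans ?_
  calc ∑ u : Fin 2 → Fin R, ‖localPair dWaveFormFactor L (a + fun i => ((u i : ℕ) : ZMod L))‖
      ≤ ∑ _u : Fin 2 → Fin R, (2 * ∑ e ∈ insert (0 : Site 2) unitSteps, |dWaveFormFactor e / Real.sqrt 2|) :=
        Finset.sum_le_sum fun u _ => norm_localPair_le dWaveFormFactor L _
    _ = (R : ℝ) ^ 2 * (2 * ∑ e ∈ insert (0 : Site 2) unitSteps, |dWaveFormFactor e / Real.sqrt 2|) := by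
        rw [Finset.sum_const, Finset.card_univ, Fintype.card_pi, Finset.prod_const, Fintype.card_fin,
          Finset.card_univ, Fintype.card_fin, nsmul_eq_mul]
        push_cast
        ring

/-- **Norm of the Kac block operator**: `‖W_R‖ ≤ (2Σ_e|g_e/√2|)² · L²` for `R ≥ 1`
(`‖B_aᴴB_a‖ ≤ ‖B_a‖² ≤ R⁴(2Σ)²`, `L²` anchors, prefactor `R⁻⁴`). [folklore] -/
theorem nc_norm_blockRepulsion_le (R : ℕ) (hR : 0 < R) :
    ‖(((((R : ℝ) ^ 4)⁻¹ : ℝ) : ℂ) • ∑ a : Literature.Probability.LatticeModels.TorusSite 2 L, (∑ u : Fin 2 → Fin R, localPair dWaveFormFactor L (a + fun i => ((u i : ℕ) : ZMod L)))ᴴ * (∑ u : Fin 2 → Fin R, localPair dWaveFormFactor L (a + fun i => ((u i : ℕ) : ZMod L))))‖ ≤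
      (2 * ∑ e ∈ insert (0 : Site 2) unitSteps, |dWaveFormFactor e / Real.sqrt 2|) ^ 2 * (L : ℝ) ^ 2 := by
  set c : ℝ := 2 * ∑ e ∈ insert (0 : Site 2) unitSteps, |dWaveFormFactor e / Real.sqrt 2| with hc
  have hRr : (0 : ℝ) < (R : ℝ) := by exact_mod_cast hR
  have hblock : ∀ a : Literature.Probability.LatticeModels.TorusSite 2 L,
      ‖(∑ u : Fin 2 → Fin R, localPair dWaveFormFactor L (a + fun i => ((u i : ℕ) : ZMod L)))ᴴ *
          (∑ u : Fin 2 → Fin R, localPair dWaveFormFactor L (a + fun i => ((u i : ℕ) : ZMod L)))‖ ≤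
        ((R : ℝ) ^ 2 * c) ^ 2 := by
    intro a
    have hB := nc_norm_blockPair_le L R a
    rw [← hc] at hB
    calc _ ≤ ‖(∑ u : Fin 2 → Fin R, localPair dWaveFormFactor L (a + fun i => ((u i : ℕ) : ZMod L)))ᴴ‖ *
          ‖∑ u : Fin 2 → Fin R, localPair dWaveFormFactor L (a + fun i => ((u i : ℕ) : ZMod L))‖ :=
          norm_mul_le _ _
      _ = ‖∑ u : Fin 2 → Fin R, localPair dWaveFormFactor L (a + fun i => ((u i : ℕ) : ZMod L))‖ ^ 2 := by
          rw [l2_opNorm_conjTranspose, sq]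
      _ ≤ ((R : ℝ) ^ 2 * c) ^ 2 := pow_le_pow_left₀ (norm_nonneg _) hB 2
  have hsum : ‖∑ a : Literature.Probability.LatticeModels.TorusSite 2 L,
      (∑ u : Fin 2 → Fin R, localPair dWaveFormFactor L (a + fun i => ((u i : ℕ) : ZMod L)))ᴴ *
        (∑ u : Fin 2 → Fin R, localPair dWaveFormFactor L (a + fun i => ((u i : ℕ) : ZMod L)))‖ ≤
      (L : ℝ) ^ 2 * ((R : ℝ) ^ 2 * c) ^ 2 := by
    refine (norm_sum_le _ _).trans ?_
    calc _ ≤ ∑ _a : Literature.Probability.LatticeModels.TorusSite 2 L, ((R : ℝ) ^ 2 * c) ^ 2 :=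
          Finset.sum_le_sum fun a _ => hblock a
      _ = (L : ℝ) ^ 2 * ((R : ℝ) ^ 2 * c) ^ 2 := by
          rw [Finset.sum_const, Finset.card_univ,
            show Fintype.card (Literature.Probability.LatticeModels.TorusSite 2 L) = L ^ 2 by
              simp [Fintype.card_pi, ZMod.card, Finset.prod_const], nsmul_eq_mul]
          push_cast
          ring
  have hcoef : ‖(((((R : ℝ) ^ 4)⁻¹ : ℝ) : ℂ))‖ = ((R : ℝ) ^ 4)⁻¹ := by
    rw [Complex.norm_real, Real.norm_eq_abs, abs_of_pos (by positivity)]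
  calc _ ≤ ‖(((((R : ℝ) ^ 4)⁻¹ : ℝ) : ℂ))‖ * ‖∑ a : Literature.Probability.LatticeModels.TorusSite 2 L,
        (∑ u : Fin 2 → Fin R, localPair dWaveFormFactor L (a + fun i => ((u i : ℕ) : ZMod L)))ᴴ *
          (∑ u : Fin 2 → Fin R, localPair dWaveFormFactor L (a + fun i => ((u i : ℕ) : ZMod L)))‖ :=
        norm_smul_le _ _
    _ ≤ ((R : ℝ) ^ 4)⁻¹ * ((L : ℝ) ^ 2 * ((R : ℝ) ^ 2 * c) ^ 2) := by
        rw [hcoef]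
        exact mul_le_mul_of_nonneg_left hsum (by positivity)
    _ = c ^ 2 * (L : ℝ) ^ 2 := by
        field_simp

end Block

/-! ### The linear floor at finite `L` (unconditional) and (N) from the response bound -/

/-- **What the tree gives unconditionally (finite `L`, every `U, μ, h, R ≥ 1, κ ≥ 0`): the LINEAR floor**
`−2κ (2Σ_e|g_e/√2|)² (L+1)² ≤ f(h,κ) + f(h,−κ) − 2f(h,0)`, `f(h,κ) = E₀(T_h + κ W_R)`. (N) asks for `κ²` in place of
`κ`; the gap between the two is exactly the response bound of `stub_neutralCurvature_of_responseLipschitz`. [folklore] -/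
theorem nc_secondDifference_ge_linear (L R : ℕ) (hR : 0 < R) (U μ h : ℝ) {κ : ℝ} (hκ : 0 ≤ κ) :
    -(2 * κ * ((2 * ∑ e ∈ insert (0 : Site 2) unitSteps, |dWaveFormFactor e / Real.sqrt 2|) ^ 2 * ((L + 1 : ℕ) : ℝ) ^ 2)) ≤ (dWaveSourceTorus (L + 1) U μ h + (κ : ℂ) • (((((R : ℝ) ^ 4)⁻¹ : ℝ) : ℂ) • ∑ a : Literature.Probability.LatticeModels.TorusSite 2 (L + 1), (∑ u : Fin 2 → Fin R, localPair dWaveFormFactor (L + 1) (a + fun i => ((u i : ℕ) : ZMod (L + 1))))ᴴ * (∑ u : Fin 2 → Fin R, localPair dWaveFormFactor (L + 1) (a + fun i => ((u i : ℕ) : ZMod (L + 1)))))).groundEnergy + (dWaveSourceTorus (L + 1) U μ h + ((-κ : ℝ) : ℂ) • (((((R : ℝ) ^ 4)⁻¹ : ℝ) : ℂ) • ∑ a : Literature.Probability.LatticeModels.TorusSite 2 (L + 1), (∑ u : Fin 2 → Fin R, localPair dWaveFormFactor (L + 1) (a + fun i => ((u i : ℕ) : ZMod (L + 1))))ᴴ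 * (∑ u : Fin 2 → Fin R, localPair dWaveFormFactor (L + 1) (a + fun i => ((u i : ℕ) : ZMod (L + 1)))))).groundEnergy - 2 * (dWaveSourceTorus (L + 1) U μ h).groundEnergy := by
  have hT := dWaveSourceTorus_isHermitian (L + 1) (isHermitian_hubbardTorusWith (L + 1) 1 U μ) h
  have hW := nc_isHermitian_blockRepulsion (L + 1) R
  have key := nc_neg_two_mul_norm_le_secondDifference_groundEnergy hT hW hκ
  have hnorm := nc_norm_blockRepulsion_le (L + 1) R hR
  have hmono : 2 * κ * ‖(((((R : ℝ) ^ 4)⁻¹ : ℝ) : ℂ) • ∑ a : Literature.Probability.LatticeModels.TorusSite 2 (L + 1), (∑ u : Fin 2 → Fin R, localPair dWaveFormFactor (L + 1) (a + fun i => ((u i : ℕ) : ZMod (L + 1))))ᴴ * (∑ u : Fin 2 → Fin R, localPair dWaveFormFactor (L + 1) (a + fun i => ((u i : ℕ) : ZMod (L + 1)))))‖ ≤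
      2 * κ * ((2 * ∑ e ∈ insert (0 : Site 2) unitSteps, |dWaveFormFactor e / Real.sqrt 2|) ^ 2 *
        ((L + 1 : ℕ) : ℝ) ^ 2) := by
    have := mul_le_mul_of_nonneg_left hnorm (by positivity : (0 : ℝ) ≤ 2 * κ)
    push_cast at this ⊢
    exact this
  linarith

/-- **(N) from the neutral response bound (`NeutralResponseLipschitz ⇒ stub_neutralCurvature`).** If, under the crux
hypotheses at `(U, δ, μ)`, for every block scale `R` there are `C_R ≥ 0`, `κ₀, h₀ > 0` with
`Re ω_{T_h − κW_R}(W_R) − Re ω_{T_h + κW_R}(W_R) ≤ C_R κ (L+1)²` for all `κ ∈ (0, κ₀)`, `h ∈ (0, h₀)`, eventually in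
`L` (`ω_A` the tracial ground state of `A`; a Lipschitz bound on the block-coherence RESPONSE across `κ = 0`, uniform
in the source), then the registered signature of (N) holds verbatim with the same `U₀, C_R, κ₀, h₀`
(`nc_response_mul_le_secondDifference_groundEnergy`). [folklore] -/
theorem stub_neutralCurvature_of_responseLipschitz
    (hNRL : ∃ U₀ : ℝ, 0 < U₀ ∧ ∀ U ∈ Set.Ioo (0:ℝ) U₀, ∀ δ ∈ Set.Ioo (0:ℝ) (1 / 2), ∀ μ : ℝ, Filter.Tendsto (fun L : ℕ => ((hubbardTorusWith 2 (L + 1) 1 U μ).groundStateFunctional totalNumber).re / ((L + 1 : ℕ) : ℝ) ^ 2) Filter.atTop (nhds (1 - δ)) → HasDWaveOrder U μ → ∀ R : ℕ, 0 < R → ∃ C : ℝ, 0 ≤ C ∧ ∃ κ₀ : ℝ, 0 < κ₀ ∧ ∃ h₀ : ℝ, 0 < h₀ ∧ ∀ κ ∈ Set.Ioo (0:ℝ) κ₀, ∀ h ∈ Set.Ioo (0:ℝ) h₀, ∀ᶠ L : ℕ in Filter.atTop, ((dWaveSourceTorus (L + 1) U μ h + ((-κ : ℝ) : ℂ) • (((((R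 : ℝ) ^ 4)⁻¹ : ℝ) : ℂ) • ∑ a : Literature.Probability.LatticeModels.TorusSite 2 (L + 1), (∑ u : Fin 2 → Fin R, localPair dWaveFormFactor (L + 1) (a + fun i => ((u i : ℕ) : ZMod (L + 1))))ᴴ * (∑ u : Fin 2 → Fin R, localPair dWaveFormFactor (L + 1) (a + fun i => ((u i : ℕ) : ZMod (L + 1)))))).groundStateFunctional ((((((R : ℝ) ^ 4)⁻¹ : ℝ) : ℂ) • ∑ a : Literature.Probability.LatticeModels.TorusSite 2 (L + 1), (∑ u : Fin 2 → Fin R, localPair dWaveFormFactor (L + 1) (a + fun i => ((u i : ℕ) : ZMod (L + 1))))ᴴ * (∑ u : Fin 2 → Fin R, localPair dWaveFormFactor (L + 1) (a + fun i => ((u i : ℕ) : ZMod (L + 1))))))).re - ((dWaveSourceTorus (L + 1) U μ h + (κ : ℂ) • (((((R : ℝ) ^ 4)⁻¹ : ℝ) : ℂ) • ∑ a : Literature.Probability.LatticeModels.TorusSite 2 (L + 1), (∑ u : Fin 2 → Fin R, localPair dWaveFormFactor (L + 1) (a + fun i => ((u i : ℕ) : ZMod (L + 1))))ᴴ * (∑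 u : Fin 2 → Fin R, localPair dWaveFormFactor (L + 1) (a + fun i => ((u i : ℕ) : ZMod (L + 1)))))).groundStateFunctional ((((((R : ℝ) ^ 4)⁻¹ : ℝ) : ℂ) • ∑ a : Literature.Probability.LatticeModels.TorusSite 2 (L + 1), (∑ u : Fin 2 → Fin R, localPair dWaveFormFactor (L + 1) (a + fun i => ((u i : ℕ) : ZMod (L + 1))))ᴴ * (∑ u : Fin 2 → Fin R, localPair dWaveFormFactor (L + 1) (a + fun i => ((u i : ℕ) : ZMod (L + 1))))))).re ≤ C * κ * ((L + 1 : ℕ) : ℝ) ^ 2) :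
    ∃ U₀ : ℝ, 0 < U₀ ∧ ∀ U ∈ Set.Ioo (0:ℝ) U₀, ∀ δ ∈ Set.Ioo (0:ℝ) (1 / 2), ∀ μ : ℝ, Filter.Tendsto (fun L : ℕ => ((hubbardTorusWith 2 (L + 1) 1 U μ).groundStateFunctional totalNumber).re / ((L + 1 : ℕ) : ℝ) ^ 2) Filter.atTop (nhds (1 - δ)) → HasDWaveOrder U μ → ∀ R : ℕ, 0 < R → ∃ C : ℝ, 0 ≤ C ∧ ∃ κ₀ : ℝ, 0 < κ₀ ∧ ∃ h₀ : ℝ, 0 < h₀ ∧ ∀ κ ∈ Set.Ioo (0:ℝ) κ₀, ∀ h ∈ Set.Ioo (0:ℝ) h₀, ∀ᶠ L : ℕ in Filter.atTop, -C * κ ^ 2 * ((L + 1 : ℕ) : ℝ) ^ 2 ≤ (dWaveSourceTorus (L + 1) U μ h + (κ : ℂ) • (((((R : ℝ) ^ 4)⁻¹ : ℝ) : ℂ) • ∑ a : Literature.Probability.LatticeModels.TorusSite 2 (L + 1), (∑ u : Fin 2 → Fin R, localPair dWaveFormFactor (L + 1) (a + fun i => ((u i : ℕ) : ZMod (L + 1))))ᴴ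 * (∑ u : Fin 2 → Fin R, localPair dWaveFormFactor (L + 1) (a + fun i => ((u i : ℕ) : ZMod (L + 1)))))).groundEnergy + (dWaveSourceTorus (L + 1) U μ h + ((-κ : ℝ) : ℂ) • (((((R : ℝ) ^ 4)⁻¹ : ℝ) : ℂ) • ∑ a : Literature.Probability.LatticeModels.TorusSite 2 (L + 1), (∑ u : Fin 2 → Fin R, localPair dWaveFormFactor (L + 1) (a + fun i => ((u i : ℕ) : ZMod (L + 1))))ᴴ * (∑ u : Fin 2 → Fin R, localPair dWaveFormFactor (L + 1) (a + fun i => ((u i : ℕ) : ZMod (L + 1)))))).groundEnergy - 2 * (dWaveSourceTorus (L + 1) U μ h).groundEnergy := by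
  obtain ⟨U₀, hU₀, hH⟩ := hNRL
  refine ⟨U₀, hU₀, fun U hU δ hδ μ hdm hord R hR => ?_⟩
  obtain ⟨C, hC, κ₀, hκ₀, h₀, hh₀, hL⟩ := hH U hU δ hδ μ hdm hord R hR
  refine ⟨C, hC, κ₀, hκ₀, h₀, hh₀, fun κ hκ h hh => ?_⟩
  filter_upwards [hL κ hκ h hh] with L hLL
  have key := nc_response_mul_le_secondDifference_groundEnergy
    (dWaveSourceTorus_isHermitian (L + 1) (isHermitian_hubbardTorusWith (L + 1) 1 U μ) h)
    (nc_isHermitian_blockRepulsion (L + 1) R) κ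
  nlinarith [mul_le_mul_of_nonneg_left hLL hκ.1.le]

/-- **The response bound from (N) (`stub_neutralCurvature ⇒ NeutralResponseLipschitz`, Griffiths direction).** From the
registered signature of (N) with constants `(C_R, κ₀, h₀)` one gets the Lipschitz response bound with constants
`(4C_R, κ₀/2, h₀)`: concavity at step `κ` and the floor at step `2κ` in `nc_sub_mul_response_le`. [folklore] -/
theorem responseLipschitz_of_stub_neutralCurvature
    (hN : ∃ U₀ : ℝ, 0 < U₀ ∧ ∀ U ∈ Set.Ioo (0:ℝ) U₀, ∀ δ ∈ Set.Ioo (0:ℝ) (1 / 2), ∀ μ : ℝ, Filter.Tendsto (fun L : ℕ => ((hubbardTorusWith 2 (L + 1) 1 U μ).groundStateFunctional totalNumber).re / ((L + 1 : ℕ) : ℝ) ^ 2) Filter.atTop (nhds (1 - δ)) → HasDWaveOrder U μ → ∀ R : ℕ, 0 < R → ∃ C : ℝ, 0 ≤ C ∧ ∃ κ₀ : ℝ, 0 < κ₀ ∧ ∃ h₀ : ℝ, 0 < h₀ ∧ ∀ κ ∈ Set.Ioo (0:ℝ) κ₀, ∀ h ∈ Set.Ioo (0:ℝ) h₀, ∀ᶠ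 L : ℕ in Filter.atTop, -C * κ ^ 2 * ((L + 1 : ℕ) : ℝ) ^ 2 ≤ (dWaveSourceTorus (L + 1) U μ h + (κ : ℂ) • (((((R : ℝ) ^ 4)⁻¹ : ℝ) : ℂ) • ∑ a : Literature.Probability.LatticeModels.TorusSite 2 (L + 1), (∑ u : Fin 2 → Fin R, localPair dWaveFormFactor (L + 1) (a + fun i => ((u i : ℕ) : ZMod (L + 1))))ᴴ * (∑ u : Fin 2 → Fin R, localPair dWaveFormFactor (L + 1) (a + fun i => ((u i : ℕ) : ZMod (L + 1)))))).groundEnergy + (dWaveSourceTorus (L + 1) U μ h + ((-κ : ℝ) : ℂ) • (((((R : ℝ) ^ 4)⁻¹ : ℝ) : ℂ) • ∑ a : Literature.Probability.LatticeModels.TorusSite 2 (L + 1), (∑ u : Fin 2 → Fin R, localPair dWaveFormFactor (L + 1) (a + fun i => ((u i : ℕ) : ZMod (L + 1))))ᴴ * (∑ u : Fin 2 → Fin R, localPair dWaveFormFactor (L + 1) (a + fun i => ((u i : ℕ) : ZMod (L + 1)))))).groundEnergy - 2 * (dWaveSourceTorus (L + 1) U μ h).groundEnergy) :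
    ∃ U₀ : ℝ, 0 < U₀ ∧ ∀ U ∈ Set.Ioo (0:ℝ) U₀, ∀ δ ∈ Set.Ioo (0:ℝ) (1 / 2), ∀ μ : ℝ, Filter.Tendsto (fun L : ℕ => ((hubbardTorusWith 2 (L + 1) 1 U μ).groundStateFunctional totalNumber).re / ((L + 1 : ℕ) : ℝ) ^ 2) Filter.atTop (nhds (1 - δ)) → HasDWaveOrder U μ → ∀ R : ℕ, 0 < R → ∃ C : ℝ, 0 ≤ C ∧ ∃ κ₀ : ℝ, 0 < κ₀ ∧ ∃ h₀ : ℝ, 0 < h₀ ∧ ∀ κ ∈ Set.Ioo (0:ℝ) κ₀, ∀ h ∈ Set.Ioo (0:ℝ) h₀, ∀ᶠ L : ℕ in Filter.atTop, ((dWaveSourceTorus (L + 1) U μ h + ((-κ : ℝ) : ℂ) • (((((R : ℝ) ^ 4)⁻¹ : ℝ) : ℂ) • ∑ a : Literature.Probability.LatticeModels.TorusSite 2 (L + 1), (∑ u : Fin 2 → Fin R, localPair dWaveFormFactor (L + 1) (a + fun i => ((u i : ℕ) : ZMod (L + 1))))ᴴ * (∑ u : Fin 2 → Fin R, localPair dWaveFormFactor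 (L + 1) (a + fun i => ((u i : ℕ) : ZMod (L + 1)))))).groundStateFunctional ((((((R : ℝ) ^ 4)⁻¹ : ℝ) : ℂ) • ∑ a : Literature.Probability.LatticeModels.TorusSite 2 (L + 1), (∑ u : Fin 2 → Fin R, localPair dWaveFormFactor (L + 1) (a + fun i => ((u i : ℕ) : ZMod (L + 1))))ᴴ * (∑ u : Fin 2 → Fin R, localPair dWaveFormFactor (L + 1) (a + fun i => ((u i : ℕ) : ZMod (L + 1))))))).re - ((dWaveSourceTorus (L + 1) U μ h + (κ : ℂ) • (((((R : ℝ) ^ 4)⁻¹ : ℝ) : ℂ) • ∑ a : Literature.Probability.LatticeModels.TorusSite 2 (L + 1), (∑ u : Fin 2 → Fin R, localPair dWaveFormFactor (L + 1) (a + fun i => ((u i : ℕ) : ZMod (L + 1))))ᴴ * (∑ u : Fin 2 → Fin R, localPair dWaveFormFactor (L + 1) (a + fun i => ((u i : ℕ) : ZMod (L + 1)))))).groundStateFunctional ((((((R : ℝ) ^ 4)⁻¹ : ℝ) : ℂ) • ∑ a : Literature.Probability.LatticeModels.TorusSite 2 (L + 1), (∑ u : Fin 2 → Fin R, localPair dWaveFormFactor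 (L + 1) (a + fun i => ((u i : ℕ) : ZMod (L + 1))))ᴴ * (∑ u : Fin 2 → Fin R, localPair dWaveFormFactor (L + 1) (a + fun i => ((u i : ℕ) : ZMod (L + 1))))))).re ≤ C * κ * ((L + 1 : ℕ) : ℝ) ^ 2 := by
  obtain ⟨U₀, hU₀, hH⟩ := hN
  refine ⟨U₀, hU₀, fun U hU δ hδ μ hdm hord R hR => ?_⟩
  obtain ⟨C, hC, κ₀, hκ₀, h₀, hh₀, hL⟩ := hH U hU δ hδ μ hdm hord R hR
  refine ⟨4 * C, by positivity, κ₀ / 2, by positivity, h₀, hh₀, fun κ hκ h hh => ?_⟩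
  have h2κ : 2 * κ ∈ Set.Ioo (0:ℝ) κ₀ := ⟨by linarith [hκ.1], by linarith [hκ.2]⟩
  filter_upwards [hL (2 * κ) h2κ h hh] with L hLL
  have hT := dWaveSourceTorus_isHermitian (L + 1) (isHermitian_hubbardTorusWith (L + 1) 1 U μ) h
  have hW := nc_isHermitian_blockRepulsion (L + 1) R
  have hch := nc_sub_mul_response_le hT hW κ (2 * κ)
  have hcv := nc_secondDifference_groundEnergy_le_zero hT hW κ
  have hκ0 : 0 < κ := hκ.1
  have key : κ * (((dWaveSourceTorus (L + 1) U μ h + ((-κ : ℝ) : ℂ) • (((((R : ℝ) ^ 4)⁻¹ : ℝ) : ℂ) • ∑ a : Literature.Probability.LatticeModels.TorusSite 2 (L + 1), (∑ u : Fin 2 → Fin R, localPair dWaveFormFactor (L + 1) (a + fun i => ((u i : ℕ) : ZMod (L + 1))))ᴴ * (∑ u : Fin 2 → Fin R, localPair dWaveFormFactor (L + 1) (a + fun i => ((u i : ℕ) : ZMod (L + 1)))))).groundStateFunctional ((((((R : ℝ) ^ 4)⁻¹ : ℝ) : ℂ) • ∑ a : Literature.Probability.LatticeModels.TorusSite 2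 (L + 1), (∑ u : Fin 2 → Fin R, localPair dWaveFormFactor (L + 1) (a + fun i => ((u i : ℕ) : ZMod (L + 1))))ᴴ * (∑ u : Fin 2 → Fin R, localPair dWaveFormFactor (L + 1) (a + fun i => ((u i : ℕ) : ZMod (L + 1))))))).re - ((dWaveSourceTorus (L + 1) U μ h + (κ : ℂ) • (((((R : ℝ) ^ 4)⁻¹ : ℝ) : ℂ) • ∑ a : Literature.Probability.LatticeModels.TorusSite 2 (L + 1), (∑ u : Fin 2 → Fin R, localPair dWaveFormFactor (L + 1) (a + fun i => ((u i : ℕ) : ZMod (L + 1))))ᴴ * (∑ u : Fin 2 → Fin R, localPair dWaveFormFactor (L + 1) (a + fun i => ((u i : ℕ) : ZMod (L + 1)))))).groundStateFunctional ((((((R : ℝ) ^ 4)⁻¹ : ℝ) : ℂ) • ∑ a : Literature.Probability.LatticeModels.TorusSite 2 (L + 1), (∑ u : Fin 2 → Fin R, localPair dWaveFormFactor (L + 1) (a + fun i => ((u i : ℕ) : ZMod (L + 1))))ᴴ * (∑ u : Fin 2 → Fin R, localPair dWaveFormFactor (L + 1) (a + fun i => ((u i : ℕ) : ZMod (L + 1))))))).re)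 ≤ κ * (4 * C * κ * ((L + 1 : ℕ) : ℝ) ^ 2) := by
    linarith
  exact le_of_mul_le_mul_left key hκ0

/-- **(N) ⟺ the `h`-uniform Lipschitz bound on the block-coherence response** (as propositions; constants
`C ↦ C`, resp. `(C, κ₀) ↦ (4C, κ₀/2)`). The registered stub is therefore already in minimal form: its entire content is
a bound on a ground-state RESPONSE of the interacting sourced torus across `κ = 0`, uniform in the source — no
finite-dimensional slack. [folklore] -/
theorem stub_neutralCurvature_iff_responseLipschitz :
    (∃ U₀ : ℝ, 0 < U₀ ∧ ∀ U ∈ Set.Ioo (0:ℝ) U₀, ∀ δ ∈ Set.Ioo (0:ℝ) (1 / 2), ∀ μ : ℝ, Filter.Tendsto (fun L : ℕ => ((hubbardTorusWith 2 (L + 1) 1 U μ).groundStateFunctional totalNumber).re / ((L + 1 : ℕ) : ℝ) ^ 2) Filter.atTop (nhds (1 - δ)) → HasDWaveOrder U μ → ∀ R : ℕ, 0 < R → ∃ C : ℝ, 0 ≤ C ∧ ∃ κ₀ : ℝ, 0 < κ₀ ∧ ∃ h₀ : ℝ, 0 < h₀ ∧ ∀ κ ∈ Set.Ioo (0:ℝ)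 κ₀, ∀ h ∈ Set.Ioo (0:ℝ) h₀, ∀ᶠ L : ℕ in Filter.atTop, -C * κ ^ 2 * ((L + 1 : ℕ) : ℝ) ^ 2 ≤ (dWaveSourceTorus (L + 1) U μ h + (κ : ℂ) • (((((R : ℝ) ^ 4)⁻¹ : ℝ) : ℂ) • ∑ a : Literature.Probability.LatticeModels.TorusSite 2 (L + 1), (∑ u : Fin 2 → Fin R, localPair dWaveFormFactor (L + 1) (a + fun i => ((u i : ℕ) : ZMod (L + 1))))ᴴ * (∑ u : Fin 2 → Fin R, localPair dWaveFormFactor (L + 1) (a + fun i => ((u i : ℕ) : ZMod (L + 1)))))).groundEnergy + (dWaveSourceTorus (L + 1) U μ h + ((-κ : ℝ) : ℂ) • (((((R : ℝ) ^ 4)⁻¹ : ℝ) : ℂ) • ∑ a : Literature.Probability.LatticeModels.TorusSite 2 (L + 1), (∑ u : Fin 2 → Fin R, localPair dWaveFormFactor (L + 1) (a + fun i => ((u i : ℕ) : ZMod (L + 1))))ᴴ * (∑ u : Fin 2 → Fin R, localPair dWaveFormFactor (L + 1) (a + fun i => ((u i : ℕ) : ZMod (L + 1)))))).groundEnergy -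 2 * (dWaveSourceTorus (L + 1) U μ h).groundEnergy) ↔
    (∃ U₀ : ℝ, 0 < U₀ ∧ ∀ U ∈ Set.Ioo (0:ℝ) U₀, ∀ δ ∈ Set.Ioo (0:ℝ) (1 / 2), ∀ μ : ℝ, Filter.Tendsto (fun L : ℕ => ((hubbardTorusWith 2 (L + 1) 1 U μ).groundStateFunctional totalNumber).re / ((L + 1 : ℕ) : ℝ) ^ 2) Filter.atTop (nhds (1 - δ)) → HasDWaveOrder U μ → ∀ R : ℕ, 0 < R → ∃ C : ℝ, 0 ≤ C ∧ ∃ κ₀ : ℝ, 0 < κ₀ ∧ ∃ h₀ : ℝ, 0 < h₀ ∧ ∀ κ ∈ Set.Ioo (0:ℝ) κ₀, ∀ h ∈ Set.Ioo (0:ℝ) h₀, ∀ᶠ L : ℕ in Filter.atTop, ((dWaveSourceTorus (L + 1) U μ h + ((-κ : ℝ) : ℂ) • (((((R : ℝ) ^ 4)⁻¹ : ℝ) : ℂ) • ∑ a : Literature.Probability.LatticeModels.TorusSite 2 (L + 1), (∑ u : Fin 2 → Fin R, localPair dWaveFormFactor (L + 1) (a + fun i => ((u i : ℕ) : ZMod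 (L + 1))))ᴴ * (∑ u : Fin 2 → Fin R, localPair dWaveFormFactor (L + 1) (a + fun i => ((u i : ℕ) : ZMod (L + 1)))))).groundStateFunctional ((((((R : ℝ) ^ 4)⁻¹ : ℝ) : ℂ) • ∑ a : Literature.Probability.LatticeModels.TorusSite 2 (L + 1), (∑ u : Fin 2 → Fin R, localPair dWaveFormFactor (L + 1) (a + fun i => ((u i : ℕ) : ZMod (L + 1))))ᴴ * (∑ u : Fin 2 → Fin R, localPair dWaveFormFactor (L + 1) (a + fun i => ((u i : ℕ) : ZMod (L + 1))))))).re - ((dWaveSourceTorus (L + 1) U μ h + (κ : ℂ) • (((((R : ℝ) ^ 4)⁻¹ : ℝ) : ℂ) • ∑ a : Literature.Probability.LatticeModels.TorusSite 2 (L + 1), (∑ u : Fin 2 → Fin R, localPair dWaveFormFactor (L + 1) (a + fun i => ((u i : ℕ) : ZMod (L + 1))))ᴴ * (∑ u : Fin 2 → Fin R, localPair dWaveFormFactor (L + 1) (a + fun i => ((u i : ℕ) : ZMod (L + 1)))))).groundStateFunctional ((((((R : ℝ) ^ 4)⁻¹ : ℝ) : ℂ) • ∑ a : Literature.Probability.LatticeModels.TorusSite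 2 (L + 1), (∑ u : Fin 2 → Fin R, localPair dWaveFormFactor (L + 1) (a + fun i => ((u i : ℕ) : ZMod (L + 1))))ᴴ * (∑ u : Fin 2 → Fin R, localPair dWaveFormFactor (L + 1) (a + fun i => ((u i : ℕ) : ZMod (L + 1))))))).re ≤ C * κ * ((L + 1 : ℕ) : ℝ) ^ 2) :=
  ⟨responseLipschitz_of_stub_neutralCurvature, stub_neutralCurvature_of_responseLipschitz⟩

end Summit.HubbardSuperconductivity.HubbardSuperconductivity.Theorems.WcbcsSsbToTorusLRO

end
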